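import Summits.ResolutionOfSingularities.ResolutionOfSingularities.Theorems.PurelyInseparableDim4IsolatedMultiplicityPairs
import Summits.ResolutionOfSingularities.ResolutionOfSingularities.Theorems.PurelyInseparableDim4EquimultipleScope
import Literature.RingTheory.MvPolynomial.VariableIdeals
import Mathlib.RingTheory.Ideal.Colon
import Mathlib.Algebra.MvPolynomial.Division
import HarnessLib
import HarnessLib.Audit.Tags

/-!
# Purely inseparable four-folds — `q`-TH POWERS OF A THREE-GENERATED IDEAL ARE NEVER ISOLATED, up to units
# (the DL-KERNEL of the slice-B architecture, bricks (K1)/(K2); cell `res-dim4-pi`, K2(p) lane)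

[OURS · counted 0 · cell `res-dim4-pi` · SLICE-B ARCHITECTURE OF RECORD `SLICE-B-ARCH-g3.md` (desk WORD #88 (a)),
bricks (K1) DL-KERNEL and (K2) UFD MERGE; seat res-dim4-p-12 g3 (K2(p) lane holder).]  Nothing here proves K2(p),
`NoIsolatedTrap p p` or resolution of singularities in dimension ≥ 4 / characteristic `p`.  AI kernel work, weaker
than expert review.

The tree's isolation lemmas (`IsolatedBand.not_isIsolated_of_le_span_finset` and its pair/triple layer corollaries,
p-5 / p-9) kill a state as soon as the `q`-fold locus ideal `J_q⁺(F)` lies in an ideal with `≤ 3` generators in `𝔪₀`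
(Krull: height `≤ 3 < 4`).  idea-4's CARD I-4-7 (DL) «two stretch-born boundary letters `a, b` with
`r_a + r_b ≥ p − 2` and `G ∈ (x_a x_b, v̄^d)` make the `v̄`-axis `p`-fold» is such a kill with the THIRD generator a
contact coordinate `v̄`, which in the polynomial frame is only available as a polynomial `h` vanishing at `0` and
only UP TO UNITS `u`, `u(0) ≠ 0`.  This file supplies exactly that form:

* §1 `hasseDeriv_mem_of_mem_pow` — `D^{(α)}(I^n) ⊆ I` for `|α| < n` (higher Leibniz rule, any ideal), sharp form
  `hasseDeriv_mem_pow_sub_of_mem_pow` — `D^{(α)}(I^n) ⊆ I^{n−|α|}`;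
  `pow_mul_hasseDeriv_mem_of_mul_mem_pow` — `u·F ∈ I^q ⇒ u^{|α|+1}·D^{(α)}F ∈ I` (`|α| < q`);
  `singLocusIdeal_le_colon_of_mul_mem_pow` — hence `J_q⁺(F) ≤ (I : u^q)`.
* §2 `not_isIsolated_of_le_colon_span_finset` — Krull for `≤ 3` generators in `𝔪₀` up to a unit `u ∉ 𝔪₀`;
  **`not_isIsolated_of_unit_mul_mem_span_triple_pow`** — `u·F ∈ (f, g, h)^q`, `f, g, h ∈ 𝔪₀`, `u(0) ≠ 0`
  ⇒ `¬ IsIsolated q F` (THE DL-KERNEL, (K1)).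
* §3 **`not_isIsolated_monomial_mul_of_unit_mul_mem`** — (DL): `u·G ∈ (x_a x_b, h^d)`, `d ≥ 2`,
  `q ≤ r_a + r_b + 2` ⇒ `x^r·G` is not isolated; **`mem_span_mul_of_mem_span_of_mem_span`** — (K2):
  `G ∈ (x_a, h^d) ∩ (x_b, h^d)`, `h ∉ (x_a, x_b)` ⇒ `G ∈ (x_a x_b, h^d)` (`K[x]` factorial, `(x_a, x_b)` prime);
  `not_isIsolated_monomial_mul_of_two_ledgers` — the two combined with units `u, u′`.
Every field, every `q`; no characteristic hypothesis.  bears_on: LADDER-RESOLUTION:D157-DOOR2 (res-dim4-pi · K2(p)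
slice B · (K1)/(K2)).  Supports stmt-ResolutionOfSingularities-16155 (helper).
-/

set_option linter.dupNamespace false -- mandated namespace of this single-conjunct summit

noncomputable section

namespace Summit.ResolutionOfSingularities.ResolutionOfSingularities.Theorems.PIDim4

namespace IsolatedBand

open MvPolynomial Finset
open Literature.AlgebraicGeometry.Resolution

variable {K : Type} [Field K]

/-! ## 1. Hasse derivatives of powers of an ideal (higher Leibniz rule) -/

/-- **`D^{(α)}(I^n) ⊆ I` for `|α| < n`** — every ideal `I`, every characteristic: in the Leibniz expansion of a
product of `n` factors from `I` at most `|α|` factors are differentiated. [folklore]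
[cite: EGAIV4, Thm. 16.11.2 (16.11.2.2)] -/
theorem hasseDeriv_mem_of_mem_pow (I : Ideal (MvPolynomial (Fin 4) K)) :
    ∀ (n : ℕ) (α : Fin 4 →₀ ℕ), α.degree < n → ∀ F ∈ I ^ n, hasseDeriv α F ∈ I := by
  classical
  intro n
  induction n with
  | zero => intro α hα; exact absurd hα (Nat.not_lt_zero _)
  | succ n ih =>
    intro α hα F hF
    rw [pow_succ] at hF
    refine Submodule.mul_induction_on hF (fun G hG a ha => ?_) (fun x y hx hy => ?_)
    · rw [Equimultiple.hasseDeriv_eq, Literature.AlgebraicGeometry.Resolution.hasseDeriv_mul]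
      refine Ideal.sum_mem _ fun βγ hβγ => ?_
      rw [Finset.HasAntidiagonal.mem_antidiagonal] at hβγ
      by_cases hβ : βγ.1.degree < n
      · have h1 := ih βγ.1 hβ G hG
        rw [Equimultiple.hasseDeriv_eq] at h1
        exact I.mul_mem_right _ h1
      · -- `|β| = n = |α|`, so `γ = 0` and the term is `D^{(α)} G · a` with `a ∈ I`
        have hdeg : βγ.1.degree + βγ.2.degree = α.degree := by rw [← map_add, hβγ]
        have hγ : βγ.2 = 0 := (Finsupp.degree_eq_zero_iff _).mp (by omega)
        rw [hγ, Literature.AlgebraicGeometry.Resolution.hasseDeriv_zero, LinearMap.id_apply]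
        exact I.mul_mem_left _ ha
    · rw [Equimultiple.hasseDeriv_eq, map_add, ← Equimultiple.hasseDeriv_eq, ← Equimultiple.hasseDeriv_eq]
      exact I.add_mem hx hy

/-- **The sharp form `D^{(α)}(I^n) ⊆ I^{n − |α|}`** (`|α| ≤ n`; every ideal, every characteristic) — the input of
the slice-B conversion lemma «generic ledger ⇒ Hasse ledger» (`D^{(i)}(h^d) ∈ (h^{d−i})`). [folklore]
[cite: EGAIV4, Thm. 16.11.2 (16.11.2.2)] -/
theorem hasseDeriv_mem_pow_sub_of_mem_pow (I : Ideal (MvPolynomial (Fin 4) K)) :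
    ∀ (n : ℕ) (α : Fin 4 →₀ ℕ), α.degree ≤ n → ∀ F ∈ I ^ n, hasseDeriv α F ∈ I ^ (n - α.degree) := by
  classical
  intro n
  induction n with
  | zero => intro α hα F _; rw [Nat.zero_sub, pow_zero, Ideal.one_eq_top]; exact Submodule.mem_top
  | succ n ih =>
    intro α hα F hF
    rcases hα.lt_or_eq with hlt | heq
    · -- `|α| ≤ n`: every `β ≤ α` is in the range of the induction hypothesis
      rw [pow_succ] at hF
      refine Submodule.mul_induction_on hF (fun G hG a ha => ?_) (fun x y hx hy => ?_)
      · rw [Equimultiple.hasseDeriv_eq, Literature.AlgebraicGeometry.Resolution.hasseDeriv_mul]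
        refine Ideal.sum_mem _ fun βγ hβγ => ?_
        rw [Finset.HasAntidiagonal.mem_antidiagonal] at hβγ
        have hdeg : βγ.1.degree + βγ.2.degree = α.degree := by rw [← map_add, hβγ]
        have h1 := ih βγ.1 (by omega) G hG
        rw [Equimultiple.hasseDeriv_eq] at h1
        by_cases hγ : βγ.2 = 0
        · -- the undifferentiated factor `a ∈ I` supplies one more power
          rw [hγ, Literature.AlgebraicGeometry.Resolution.hasseDeriv_zero, LinearMap.id_apply]
          have hβ : βγ.1 = α := by have := hβγ; rw [hγ, add_zero] at this; exact this
          rw [hβ] at h1 ⊢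
          rw [show n + 1 - α.degree = (n - α.degree) + 1 by omega, pow_succ]
          exact Ideal.mul_mem_mul h1 ha
        · have hγpos : 0 < βγ.2.degree := by
            rw [Nat.pos_iff_ne_zero, Ne, Finsupp.degree_eq_zero_iff]; exact hγ
          exact Ideal.mul_mem_right _ _ (Ideal.pow_le_pow_right (by omega) h1)
      · rw [Equimultiple.hasseDeriv_eq, map_add, ← Equimultiple.hasseDeriv_eq, ← Equimultiple.hasseDeriv_eq]
        exact Ideal.add_mem _ hx hy
    · -- `|α| = n + 1`: the target is `I^0 = ⊤`
      rw [heq, Nat.sub_self, pow_zero, Ideal.one_eq_top]; exact Submodule.mem_top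

/-- **Unit multiples**: if `u · F ∈ I^q` then `u^{|α|+1} · D^{(α)} F ∈ I` for every `|α| < q` (peel the Leibniz
expansion of `D^{(α)}(uF)` by induction on `|α|`). [folklore] -/
theorem pow_mul_hasseDeriv_mem_of_mul_mem_pow (I : Ideal (MvPolynomial (Fin 4) K)) {q : ℕ}
    {u F : MvPolynomial (Fin 4) K} (hF : u * F ∈ I ^ q) :
    ∀ (n : ℕ) (α : Fin 4 →₀ ℕ), α.degree = n → n < q → u ^ (n + 1) * hasseDeriv α F ∈ I := by
  classical
  intro n
  induction n using Nat.strong_induction_on with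
  | _ n ih =>
    intro α hαn hnq
    -- Leibniz for `u * F`
    have hL := hasseDeriv_mem_of_mem_pow I q α (by omega) _ hF
    have h0 : ((0 : Fin 4 →₀ ℕ), α) ∈ Finset.HasAntidiagonal.antidiagonal α :=
      Finset.HasAntidiagonal.mem_antidiagonal.mpr (zero_add α)
    rw [Equimultiple.hasseDeriv_eq, Literature.AlgebraicGeometry.Resolution.hasseDeriv_mul,
      ← Finset.add_sum_erase _ _ h0, Literature.AlgebraicGeometry.Resolution.hasseDeriv_zero,
      LinearMap.id_apply] at hL
    -- `u · D^{(α)}F = D^{(α)}(uF) − Σ_{γ < α} D^{(α−γ)}u · D^{(γ)}F`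
    have hsum : u ^ (n + 1) * hasseDeriv α F =
        u ^ n * (u * Literature.AlgebraicGeometry.Resolution.hasseDeriv K α F +
          ∑ x ∈ (Finset.HasAntidiagonal.antidiagonal α).erase (0, α),
            Literature.AlgebraicGeometry.Resolution.hasseDeriv K x.1 u *
              Literature.AlgebraicGeometry.Resolution.hasseDeriv K x.2 F) -
        ∑ x ∈ (Finset.HasAntidiagonal.antidiagonal α).erase (0, α),
          u ^ n * (Literature.AlgebraicGeometry.Resolution.hasseDeriv K x.1 u *
            Literature.AlgebraicGeometry.Resolution.hasseDeriv K x.2 F) := by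
      rw [mul_add, Finset.mul_sum, add_sub_cancel_right, Equimultiple.hasseDeriv_eq, pow_succ, mul_assoc]
    rw [hsum]
    refine I.sub_mem (I.mul_mem_left _ hL) (Ideal.sum_mem _ fun βγ hβγ => ?_)
    obtain ⟨hne, hmem⟩ := Finset.mem_erase.mp hβγ
    rw [Finset.HasAntidiagonal.mem_antidiagonal] at hmem
    -- `|γ| < |α|`
    have hdeg : βγ.1.degree + βγ.2.degree = n := by rw [← map_add, hmem, hαn]
    have hγlt : βγ.2.degree < n := by
      by_contra hge
      push Not at hge
      have hβ0 : βγ.1 = 0 := (Finsupp.degree_eq_zero_iff _).mp (by omega)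
      apply hne
      refine Prod.ext hβ0 ?_
      have := hmem
      rw [hβ0, zero_add] at this
      exact this
    have hγ := ih βγ.2.degree hγlt βγ.2 rfl (by omega)
    -- `u^n · D^β u · D^γ F = (u^{n − |γ| − 1} · D^β u) · (u^{|γ|+1} D^γ F)`
    have hsplit : u ^ n * (Literature.AlgebraicGeometry.Resolution.hasseDeriv K βγ.1 u *
        Literature.AlgebraicGeometry.Resolution.hasseDeriv K βγ.2 F) =
        u ^ (n - (βγ.2.degree + 1)) * Literature.AlgebraicGeometry.Resolution.hasseDeriv K βγ.1 u *
          (u ^ (βγ.2.degree + 1) * hasseDeriv βγ.2 F) := by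
      rw [Equimultiple.hasseDeriv_eq, show u ^ n = u ^ (n - (βγ.2.degree + 1)) * u ^ (βγ.2.degree + 1) by
        rw [← pow_add]; congr 1; omega]
      ring
    rw [hsplit]
    exact I.mul_mem_left _ hγ

/-- **`u · F ∈ I^q` puts the whole `q`-fold locus ideal of `F` inside `I` up to the unit**:
`u^q · J_q⁺(F) ⊆ I`. [folklore] -/
theorem singLocusIdeal_le_colon_of_mul_mem_pow (I : Ideal (MvPolynomial (Fin 4) K)) {q : ℕ}
    {u F : MvPolynomial (Fin 4) K} (hF : u * F ∈ I ^ q) :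
    singLocusIdeal q F ≤ I.colon {u ^ q} := by
  unfold singLocusIdeal
  rw [Ideal.span_le]
  rintro _ ⟨α, -, hαq, rfl⟩
  rw [SetLike.mem_coe, Submodule.mem_colon_singleton, smul_eq_mul]
  have h := pow_mul_hasseDeriv_mem_of_mul_mem_pow I hF α.degree α rfl hαq
  have hsplit : hasseDeriv α F * u ^ q = u ^ (q - (α.degree + 1)) * (u ^ (α.degree + 1) * hasseDeriv α F) := by
    rw [show u ^ q = u ^ (q - (α.degree + 1)) * u ^ (α.degree + 1) by rw [← pow_add]; congr 1; omega]
    ring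
  rw [hsplit]
  exact I.mul_mem_left _ h

/-! ## 2. Krull: three generators in `𝔪₀` and a unit never isolate the origin -/

/-- **Krull for `≤ 3` generators, up to a unit**: if `u ∉ 𝔪₀` and `J_q⁺(G) · u^{q} ⊆ (T)` for a finite set
`T ⊆ 𝔪₀` with at most three elements, the origin is not an isolated point of the `q`-fold locus (a minimal prime
of `(T)` inside `𝔪₀` has height `≤ 3 < 4` and contains `J_q⁺(G)` because it misses `u`). [folklore] -/
theorem not_isIsolated_of_le_colon_span_finset {q : ℕ} {G u : MvPolynomial (Fin 4) K}
    {T : Finset (MvPolynomial (Fin 4) K)} (hT : ∀ f ∈ T, f ∈ originIdeal K) (hcard : T.card ≤ 3)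
    (hu : u ∉ originIdeal K)
    (hJ : singLocusIdeal q G ≤ (Ideal.span (T : Set (MvPolynomial (Fin 4) K))).colon {u ^ q}) :
    ¬ IsIsolated q G := by
  classical
  haveI := originIdeal_isPrime (K := K)
  have hI : Ideal.span (T : Set (MvPolynomial (Fin 4) K)) ≤ originIdeal K := by
    rw [Ideal.span_le]
    exact fun f hf => hT f (Finset.mem_coe.mp hf)
  obtain ⟨P₁, hP₁, hP₁le⟩ := Ideal.exists_minimalPrimes_le hI
  haveI hP₁prime : P₁.IsPrime := hP₁.1.1
  have hht : P₁.height ≤ 3 :=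
    le_trans (Ideal.height_le_card_of_mem_minimalPrimes_span_finset hP₁) (by exact_mod_cast hcard)
  have hne : P₁ ≠ originIdeal K := by
    intro h
    rw [h] at hht
    have h4 := four_le_height_originIdeal (K := K)
    have : (4 : ℕ∞) ≤ 3 := le_trans h4 hht
    exact absurd this (by decide)
  have huP : u ^ q ∉ P₁ := fun h => hu (hP₁le (hP₁prime.mem_of_pow_mem _ h))
  have hJP : singLocusIdeal q G ≤ P₁ := by
    intro g hg
    have h := hJ hg
    rw [Submodule.mem_colon_singleton, smul_eq_mul] at h
    exact (hP₁prime.mem_or_mem (hP₁.1.2 h)).resolve_right huP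
  rintro ⟨-, hall⟩
  obtain ⟨P, hP, hPle⟩ := Ideal.exists_minimalPrimes_le hJP
  have hP𝔪 : P = originIdeal K := hall P hP (hPle.trans hP₁le)
  exact hne (le_antisymm hP₁le (hP𝔪 ▸ hPle))

/-- Units at the origin: `u ∉ 𝔪₀ ↔ u(0) ≠ 0`. [folklore] -/
theorem not_mem_originIdeal_iff {u : MvPolynomial (Fin 4) K} :
    u ∉ originIdeal K ↔ MvPolynomial.eval (0 : Fin 4 → K) u ≠ 0 := by
  unfold originIdeal
  rw [RingHom.mem_ker]

/-- **THE DL-KERNEL** (slice-B architecture (K1)): if `u · F ∈ (f, g, h)^q` with `f, g, h ∈ 𝔪₀` and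
`u(0) ≠ 0`, the origin is NOT an isolated `q`-fold point of `z^q + F`.  (I-4-7 (DL) and every «axis is `p`-fold»
witness criterion of the slice-B/C games are instances, with `f, g` two boundary letters and `h` a contact
polynomial.) [OURS] [cite: EGAIV4, Thm. 16.11.2 (16.11.2.2)] -/
theorem not_isIsolated_of_unit_mul_mem_span_triple_pow {q : ℕ} {F u f g h : MvPolynomial (Fin 4) K}
    (hu : MvPolynomial.eval (0 : Fin 4 → K) u ≠ 0) (hf : f ∈ originIdeal K) (hg : g ∈ originIdeal K)
    (hh : h ∈ originIdeal K) (hF : u * F ∈ (Ideal.span {f, g, h}) ^ q) : ¬ IsIsolated q F := by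
  classical
  have hT : ∀ x ∈ ({f, g, h} : Finset (MvPolynomial (Fin 4) K)), x ∈ originIdeal K := by
    intro x hx
    simp only [Finset.mem_insert, Finset.mem_singleton] at hx
    rcases hx with rfl | rfl | rfl
    exacts [hf, hg, hh]
  refine not_isIsolated_of_le_colon_span_finset hT Finset.card_le_three (not_mem_originIdeal_iff.mpr hu) ?_
  rw [Finset.coe_insert, Finset.coe_insert, Finset.coe_singleton]
  exact singLocusIdeal_le_colon_of_mul_mem_pow _ hF

/-! ## 3. The frame corollaries: I-4-7 (DL) and the UFD merge of two ledgers -/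

/-- `x^r ∈ (x_a, x_b, h)^{r_a + r_b}`. [folklore] -/
theorem monomial_mem_span_pow {a b : Fin 4} (hab : a ≠ b) (h : MvPolynomial (Fin 4) K) (r : Fin 4 →₀ ℕ) :
    (monomial r (1 : K)) ∈ (Ideal.span {X a, X b, h} : Ideal (MvPolynomial (Fin 4) K)) ^ (r a + r b) := by
  classical
  set I : Ideal (MvPolynomial (Fin 4) K) := Ideal.span {X a, X b, h} with hI
  have hXa : (X a : MvPolynomial (Fin 4) K) ∈ I := Ideal.subset_span (by simp)
  have hXb : (X b : MvPolynomial (Fin 4) K) ∈ I := Ideal.subset_span (by simp)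
  -- split off `x_a^{r_a}` and `x_b^{r_b}`
  have hle_a : Finsupp.single a (r a) ≤ r := Finsupp.single_le_iff.mpr le_rfl
  have hle_b : Finsupp.single b (r b) ≤ r - Finsupp.single a (r a) := by
    refine Finsupp.single_le_iff.mpr ?_
    rw [Finsupp.tsub_apply, Finsupp.single_eq_of_ne hab.symm, Nat.sub_zero]
  have hsplit : monomial r (1 : K) = X a ^ r a * (X b ^ r b *
      monomial (r - Finsupp.single a (r a) - Finsupp.single b (r b)) 1) := by
    rw [X_pow_eq_monomial, X_pow_eq_monomial, monomial_mul, monomial_mul, one_mul, one_mul,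
      add_tsub_cancel_of_le hle_b, add_tsub_cancel_of_le hle_a]
  rw [hsplit, pow_add]
  exact Ideal.mul_mem_mul (Ideal.pow_mem_pow hXa _) (Ideal.mul_mem_right _ _ (Ideal.pow_mem_pow hXb _))

/-- **I-4-7 (DL), KERNEL FORM**: if two boundary letters `a ≠ b` with `r_a + r_b + 2 ≥ q` and a polynomial
`h ∈ 𝔪₀` satisfy `u · G ∈ (x_a x_b, h^d)` for some `u(0) ≠ 0` and `d ≥ 2`, then the origin is not an isolated `q`-fold
point of `z^q + x^r G` («two stretch-born letters with `r_a + r_b ≥ p − 2` and `G ∈ (x_a x_b, v̄^d)` make the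
`v̄`-axis `p`-fold» — here `v̄` is ANY polynomial `h` vanishing at `0`). [OURS] [cite: EGAIV4, Thm. 16.11.2 (16.11.2.2)] -/
theorem not_isIsolated_monomial_mul_of_unit_mul_mem {q d : ℕ} {a b : Fin 4} (hab : a ≠ b)
    {h G u : MvPolynomial (Fin 4) K} (hh : h ∈ originIdeal K) (hu : MvPolynomial.eval (0 : Fin 4 → K) u ≠ 0)
    (hG : u * G ∈ Ideal.span {X a * X b, h ^ d}) (hd : 2 ≤ d) (r : Fin 4 →₀ ℕ) (hq : q ≤ r a + r b + 2) :
    ¬ IsIsolated q (monomial r (1 : K) * G) := by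
  classical
  set I : Ideal (MvPolynomial (Fin 4) K) := Ideal.span {X a, X b, h} with hI
  have hXa : (X a : MvPolynomial (Fin 4) K) ∈ I := Ideal.subset_span (by simp)
  have hXb : (X b : MvPolynomial (Fin 4) K) ∈ I := Ideal.subset_span (by simp)
  have hhI : h ∈ I := Ideal.subset_span (by simp)
  have h2 : u * G ∈ I ^ 2 := by
    refine (Ideal.span_le.mpr ?_) hG
    rintro x hx
    simp only [Set.mem_insert_iff, Set.mem_singleton_iff] at hx
    rcases hx with rfl | rfl
    · rw [pow_two]; exact Ideal.mul_mem_mul hXa hXb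
    · exact Ideal.pow_le_pow_right hd (Ideal.pow_mem_pow hhI d)
  refine not_isIsolated_of_unit_mul_mem_span_triple_pow hu (IsolatedScope.X_mem_originIdeal a)
    (IsolatedScope.X_mem_originIdeal b) hh (Ideal.pow_le_pow_right hq ?_)
  rw [mul_left_comm, pow_add]
  exact Ideal.mul_mem_mul (monomial_mem_span_pow hab h r) h2

/-- **UFD MERGE OF TWO LEDGERS** (slice-B architecture (K2)): `G ∈ (x_a, h^d) ∩ (x_b, h^d)` with `h ∉ (x_a, x_b)`
(`a ≠ b`) forces `G ∈ (x_a x_b, h^d)` — `K[x]` is factorial and `(x_a, x_b)` is prime. [folklore] -/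
theorem mem_span_mul_of_mem_span_of_mem_span {a b : Fin 4} (hab : a ≠ b) {h G : MvPolynomial (Fin 4) K}
    {d : ℕ} (hh : h ∉ Ideal.span {(X a : MvPolynomial (Fin 4) K), X b})
    (ha : G ∈ Ideal.span {(X a : MvPolynomial (Fin 4) K), h ^ d})
    (hb : G ∈ Ideal.span {(X b : MvPolynomial (Fin 4) K), h ^ d}) :
    G ∈ Ideal.span {(X a * X b : MvPolynomial (Fin 4) K), h ^ d} := by
  classical
  haveI hP : (Ideal.span {(X a : MvPolynomial (Fin 4) K), X b}).IsPrime := by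
    have := Literature.RingTheory.MvPolynomial.isPrime_span_X_image (R := K) ({a, b} : Set (Fin 4))
    rwa [Set.image_pair] at this
  obtain ⟨s, t, hst⟩ := Ideal.mem_span_pair.mp ha
  obtain ⟨s', t', hst'⟩ := Ideal.mem_span_pair.mp hb
  -- `(t − t′) h^d ∈ (x_a, x_b)`, hence `t − t′ ∈ (x_a, x_b)`
  have hdiff : (t - t') * h ^ d ∈ Ideal.span {(X a : MvPolynomial (Fin 4) K), X b} := by
    refine Ideal.mem_span_pair.mpr ⟨-s, s', ?_⟩
    linear_combination hst' - hst
  have hhd : h ^ d ∉ Ideal.span {(X a : MvPolynomial (Fin 4) K), X b} := fun hp => hh (hP.mem_of_pow_mem d hp)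
  obtain ⟨α, β, hαβ⟩ := Ideal.mem_span_pair.mp ((hP.mem_or_mem hdiff).resolve_right hhd)
  -- `x_b (s′ − β h^d) = x_a (s + α h^d)`, so `x_a ∣ s′ − β h^d`
  have hdvd : (X a : MvPolynomial (Fin 4) K) ∣ X b * (s' - β * h ^ d) :=
    ⟨s + α * h ^ d, by linear_combination hst' - hst - h ^ d * hαβ⟩
  rcases X_dvd_mul_iff.mp hdvd with hX | ⟨w, hw⟩
  · exact absurd (X_dvd_X.mp hX) hab
  · exact Ideal.mem_span_pair.mpr ⟨w, β * X b + t', by linear_combination hst' - X b * hw⟩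

/-- (DL) with two separate ledgers: `u·G ∈ (x_a, h^d)`, `u′·G ∈ (x_b, h^d)`, `h ∈ 𝔪₀ ∖ (x_a, x_b)`, `u(0), u′(0) ≠ 0`,
`d ≥ 2`, `r_a + r_b + 2 ≥ q` ⇒ `x^r G` is not isolated. [OURS] [cite: EGAIV4, Thm. 16.11.2 (16.11.2.2)] -/
theorem not_isIsolated_monomial_mul_of_two_ledgers {q d : ℕ} {a b : Fin 4} (hab : a ≠ b)
    {h G u u' : MvPolynomial (Fin 4) K} (hh : h ∈ originIdeal K)
    (hh' : h ∉ Ideal.span {(X a : MvPolynomial (Fin 4) K), X b})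
    (hu : MvPolynomial.eval (0 : Fin 4 → K) u ≠ 0) (hu' : MvPolynomial.eval (0 : Fin 4 → K) u' ≠ 0)
    (hGa : u * G ∈ Ideal.span {(X a : MvPolynomial (Fin 4) K), h ^ d})
    (hGb : u' * G ∈ Ideal.span {(X b : MvPolynomial (Fin 4) K), h ^ d}) (hd : 2 ≤ d) (r : Fin 4 →₀ ℕ)
    (hq : q ≤ r a + r b + 2) : ¬ IsIsolated q (monomial r (1 : K) * G) := by
  have ha : u' * u * G ∈ Ideal.span {(X a : MvPolynomial (Fin 4) K), h ^ d} := by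
    rw [mul_assoc]; exact Ideal.mul_mem_left _ _ hGa
  have hb : u' * u * G ∈ Ideal.span {(X b : MvPolynomial (Fin 4) K), h ^ d} := by
    rw [mul_comm u' u, mul_assoc]; exact Ideal.mul_mem_left _ _ hGb
  refine not_isIsolated_monomial_mul_of_unit_mul_mem hab hh (u := u' * u) ?_
    (mem_span_mul_of_mem_span_of_mem_span hab hh' ha hb) hd r hq
  rw [map_mul]
  exact mul_ne_zero hu' hu

end IsolatedBand

end Summit.ResolutionOfSingularities.ResolutionOfSingularities.Theorems.PIDim4

end
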